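import Mathlib
import Summits.MatrixMultiplication.MatrixMultiplication.Theses.SnSubsetDichotomy

/-!
# Sketch (ideator 4, round 2) — crux `PolynomialSlack` (stmt-MatrixMultiplication-8306)

Idea card `deficit-budget-positivity`: first lemmas of the line, stated over existing
declarations.  Nothing is proved here; every `def … : Prop` must only ELABORATE.

Notation.  For `X ⊆ S_n`: `marg X i j = P_{x ∈ X}(x j = i)` (a doubly stochastic matrix `D_X`),
`cmarg = D_X − J/n` (`E_X`), `deficit X = Σ_{i,j} max(0, 1 − n·D_X(i,j))²` (squared relative
deficits; entrywise `E_X ≥ −1/n`).  Quotient sets `A = S⁻¹T`, `B = T⁻¹U`, `C' = S⁻¹U`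
(`quotL`), and the level-one triple form
`tau S T U = Σ_{i,j,k} E_A(i,j) E_B(j,k) E_{C'}(i,k) = Tr(E_A E_B E_{C'}ᵀ) = E[fix(c'⁻¹ a b)] − 1`
(`a,b,c'` independent uniform on `A,B,C'`).
-/

namespace Summit.MatrixMultiplication.MatrixMultiplication.Cruxes.PolynomialSlack.IdeaSketch4

open Finset

noncomputable section

variable {n : ℕ}

/-- marginal matrix `D_X(i,j) = P_{x ∈ X}(x j = i)`. -/
def marg (X : Finset (Equiv.Perm (Fin n))) (i j : Fin n) : ℝ :=
  ((X.filter (fun σ => σ j = i)).card : ℝ) / X.card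

/-- centred marginal `E_X = D_X − J/n`. -/
def cmarg (X : Finset (Equiv.Perm (Fin n))) (i j : Fin n) : ℝ := marg X i j - 1 / (n : ℝ)

/-- squared relative deficits `V(X) = Σ_{i,j} max(0, 1 − n·D_X(i,j))²` (`= n² ‖E_X⁻‖_F²`). -/
def deficit (X : Finset (Equiv.Perm (Fin n))) : ℝ :=
  ∑ i : Fin n, ∑ j : Fin n, (max 0 (1 - (n : ℝ) * marg X i j)) ^ 2

/-- left quotient set `X⁻¹Y = {x⁻¹ y}`. -/
def quotL (X Y : Finset (Equiv.Perm (Fin n))) : Finset (Equiv.Perm (Fin n)) :=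
  Finset.image₂ (fun x y => x⁻¹ * y) X Y

/-- density in `S_n`. -/
def dens (Z : Finset (Equiv.Perm (Fin n))) : ℝ := (Z.card : ℝ) / (n.factorial : ℝ)

/-- the lopsidedness gauge `√(μ_Z · log(2/μ_Z))` of a quotient set. -/
def lops (Z : Finset (Equiv.Perm (Fin n))) : ℝ := Real.sqrt (dens Z * Real.log (2 / dens Z))

/-- level-one triple form `τ = Tr(E_A E_B E_{C'}ᵀ) = E[fix(c'⁻¹ab)] − 1`. -/
def tau (S T U : Finset (Equiv.Perm (Fin n))) : ℝ :=
  ∑ i : Fin n, ∑ j : Fin n, ∑ k : Fin n,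
    cmarg (quotL S T) i j * cmarg (quotL T U) j k * cmarg (quotL S U) i k

/-- all elements of `X` have the same sign (one coset of `A_n`; WLOG at cost 8 in `|S||T||U|`). -/
def ParityPure (X : Finset (Equiv.Perm (Fin n))) : Prop :=
  ∀ σ ∈ X, ∀ τ ∈ X, Equiv.Perm.sign σ = Equiv.Perm.sign τ

/-- **LEVEL-ONE PINNING** (first lemma; provable now from the tree's unitary Wedderburn /
Fourier-inversion / Parseval machinery used for `BCGPU2023_thm32_holds`, plus the dimension gap
"every irrep of `S_n` of dimension `∉ {1, n−1}` has dimension `≥ n(n−3)/2`" (Rasala 1977) and the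
identification of the two `(n−1)`-dimensional blocks with `E_X` on `1^⊥`): in the window
`N ≥ 12 (n!)^{3/2}/n` (i.e. `C < 1`) the standard representation alone must carry the whole
negative excess `|G|N − 2N²` of the TPP identity, which pins the level-one agreement statistic:
`E[fix(c'⁻¹ab)] ≤ 1 − 0.85/(n−1)`. -/
def LevelOnePinning : Prop :=
  ∃ n₀ : ℕ, ∀ n ≥ n₀, ∀ S T U : Finset (Equiv.Perm (Fin n)),
    Literature.Combinatorics.Additive.TripleProductProperty S T U →
    ParityPure S → ParityPure T → ParityPure U →
    12 * (n.factorial : ℝ) ^ ((3 : ℝ) / 2) / (n : ℝ) ≤ ((S.card * T.card * U.card : ℕ) : ℝ) →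
    tau S T U ≤ -(17 / 20) / ((n : ℝ) - 1)

/-- **DEFICIT BUDGET, sharp form** (one-sided, globalness-free level-one inequality): for every
`X ⊆ S_n`, `Σ_{i,j} max(0, 1 − n D_X(i,j))² ≤ K · n · log(2 n!/|X|)`.  Jensen on
`Σ_{x∈X} e^{λ(m − F(x))}`, `F(π) = Σ_j η_{π(j),j}`, against a Bernstein MGF bound for randomly permuted
sums with variance proxy `(1/n)Σ η²` (Bercu–Delyon–Rio 2015, quoted as Thm 1.5 of Albert 2019,
arXiv:1805.03579 — a FACT to vendor in mgf form). -/
def DeficitBudget : Prop :=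
  ∃ K : ℝ, 0 < K ∧ ∀ n ≥ 2, ∀ X : Finset (Equiv.Perm (Fin n)), X.Nonempty →
    deficit X ≤ K * (n : ℝ) * Real.log (2 * (n.factorial : ℝ) / (X.card : ℝ))

/-- **DEFICIT BUDGET, weak form** (loses `H_n ≤ 1 + log n`; PROVABLE NOW, elementary): Hoeffding
double-centring `d_{ij} = η_{ij} − η̄_{i·} − η̄_{·j} + η̄`, Doob martingale exposing the columns in
order of non-increasing `Σ_i d_{ij}²`, conditional variances `≤ (2/(n−k+1))Σ_i(d_{ik}² + r_{ik}²)`,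
Chebyshev's sum inequality, Bennett for increments `|D_k| ≤ 8`, then Jensen with `λ = 1/(11 H_n)`:
`Σ η² ≤ 22 · n · H_n · log(n!/|X|)`. -/
def DeficitBudgetWeak : Prop :=
  ∀ n ≥ 2, ∀ X : Finset (Equiv.Perm (Fin n)), X.Nonempty →
    deficit X ≤ 22 * (n : ℝ) * (1 + Real.log (n : ℝ)) * Real.log (2 * (n.factorial : ℝ) / (X.card : ℝ))

/-- **LOPSIDED NEAR THE WALL** (the theorem of the line in the first window): a TPP triple with
`|S||T||U| ≥ 100 (n!)^{3/2}/n` has `√(n/(1+log n)) · |S||T||U|/(n!)^{3/2} ≤ K Σ_Z √(μ_Z log(2/μ_Z))`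
over its three quotient sets — some quotient set is dense (the `1 + log n` disappears with the
sharp budget). -/
def LopsidedNearWall : Prop :=
  ∃ K : ℝ, 0 < K ∧ ∃ n₀ : ℕ, ∀ n ≥ n₀, ∀ S T U : Finset (Equiv.Perm (Fin n)),
    Literature.Combinatorics.Additive.TripleProductProperty S T U →
    100 * (n.factorial : ℝ) ^ ((3 : ℝ) / 2) / (n : ℝ) ≤ ((S.card * T.card * U.card : ℕ) : ℝ) →
    Real.sqrt ((n : ℝ) / (1 + Real.log (n : ℝ))) * ((S.card * T.card * U.card : ℕ) : ℝ) ≤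
      K * (n.factorial : ℝ) ^ ((3 : ℝ) / 2) * (lops (quotL S T) + lops (quotL T U) + lops (quotL S U))

/-- **BALANCED THREE-QUARTERS** (corollary: balanced triples sit `n^{1/4−o(1)}` below the
quasirandom wall `(n!)^{3/2}/√(n−1)` of `BCGPU2023_thm32`; exponent `3/2` on `log n` with the weak
budget, `3/4` with the sharp one). -/
def BalancedThreeQuarters : Prop :=
  ∃ K : ℝ, 0 < K ∧ ∃ n₀ : ℕ, ∀ n ≥ n₀, ∀ S T U : Finset (Equiv.Perm (Fin n)),
    Literature.Combinatorics.Additive.TripleProductProperty S T U →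
    S.card = T.card → T.card = U.card →
    (S.card : ℝ) ^ (3 : ℕ) ≤
      K * Real.log (n : ℝ) ^ ((3 : ℝ) / 2) * (n : ℝ) ^ (-(3 : ℝ) / 4) * (n.factorial : ℝ) ^ ((3 : ℝ) / 2)

/-- the crux restricted to balanced triples and exponents `C < C₀`. -/
def PolynomialSlackBalancedUpTo (C₀ : ℝ) : Prop :=
  ∀ C : ℝ, C < C₀ → ∃ n₀ : ℕ, ∀ n ≥ n₀, ∀ S T U : Finset (Equiv.Perm (Fin n)),
    Literature.Combinatorics.Additive.TripleProductProperty S T U →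
    S.card = T.card → T.card = U.card →
    ((S.card * T.card * U.card : ℕ) : ℝ) * (n : ℝ) ^ C ≤ (n.factorial : ℝ) ^ ((3 : ℝ) / 2)

/-- composition of the line (each arrow elementary; the first is the positivity argument). -/
def LineComposition : Prop :=
  (LevelOnePinning → DeficitBudgetWeak → LopsidedNearWall) ∧
  (LopsidedNearWall → BalancedThreeQuarters) ∧
  (BalancedThreeQuarters → PolynomialSlackBalancedUpTo (3 / 4))

/-- sanity: the crux implies every balanced window statement. -/
def CruxImpliesWindow : Prop :=
  Summit.MatrixMultiplication.MatrixMultiplication.Theses.SnSubsetDichotomy.PolynomialSlack →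
    ∀ C₀ : ℝ, PolynomialSlackBalancedUpTo C₀

/-- the named continuation for the lopsided regime (open; second stage of the line):
no TPP triple near the wall has a dense unique-product pair.  Stated with an explicit density
floor `n^{1−2C}/log n` matching `LopsidedNearWall`. -/
def DensePairObstruction : Prop :=
  ∀ C : ℝ, C < 1 → ∃ n₀ : ℕ, ∀ n ≥ n₀, ∀ S T U : Finset (Equiv.Perm (Fin n)),
    Literature.Combinatorics.Additive.TripleProductProperty S T U →
    (n.factorial : ℝ) ^ ((3 : ℝ) / 2) * (n : ℝ) ^ (-C) ≤ ((S.card * T.card * U.card : ℕ) : ℝ) →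
    (n : ℝ) ^ (1 - 2 * C) / Real.log (n : ℝ) ≤ max (dens (quotL S T)) (max (dens (quotL T U)) (dens (quotL S U))) →
    False

end

end Summit.MatrixMultiplication.MatrixMultiplication.Cruxes.PolynomialSlack.IdeaSketch4
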